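import Literature.Probability.RandomPlanarGeometry.SLERestrictionDerivMeasurable
import HarnessLib

/-!
# The alive functional along one path: `aliveFn_t = min (min_{s ≤ t} dist(W_s, g_s(A))) 1`, continuously

Pathwise companion of `SLERestrictionAlive`: for ONE continuous driving function `W` with
`W 0 = 0`, a nonempty `*`-hull `A` and a dense sequence `(a_k)` of `A ∩ ℍ`:

* `aliveFn_eq_zero_of_not_disjoint` — once the hulls have reached `A`, `aliveFn = 0`;
* `aliveFn_le_min_infDist` — at an alive time `s ≤ t`, `aliveFn_t ≤ min dist(0, A_s - W_s) 1`
  (a clipped distance at a rational time just after `s` is close, by continuity in time of the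
  flow, and the slid points `g_s(a_k) - W_s` are dense in the slid hull `A_s - W_s`);
* `exists_aliveFn_eq_min` — at an alive time `t`, `aliveFn_t = min (m s₀) 1` with `s₀` a
  minimiser of `s ↦ m_s = dist(0, A_s - W_s)` on `[0, t]`;
* `exists_lt_disjoint` — the set of alive times is open to the right (at a hull-hitting time a
  point of `A` is swallowed, `IsHullHitTime.exists_mem_closedHull`);
* `continuous_aliveFn` — **`t ↦ aliveFn_t` is continuous** (it tends to `0` at the hitting time
  `T_A` by the extension criterion), the regularity making the localising times
  `S_n = inf{t : aliveFn_t ≤ 1/n}` stopping times of a continuous adapted process ([LSW] §5: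
  the local martingale `Y_t`, `t < T`, is localised along `T_n ↑ T`).

## References

* G. F. Lawler, O. Schramm, W. Werner, *Conformal restriction: the chordal case* (2003), §5
  [LawlerSchrammWerner2003Restriction].
-/

noncomputable section

open Set Filter Metric Function MeasureTheory
open _root_.Complex _root_.Topology
open UpperHalfPlane (upperHalfPlaneSet)
open scoped NNReal

namespace Literature.Probability.RandomPlanarGeometry

namespace Loewner

variable {Ω : Type*} {W : Ω → ℝ≥0 → ℝ} {A : Set ℂ} {t : ℝ≥0} {a : ℕ → ℂ} {ω : Ω}

/-! ### Dead times -/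

/-- **Once the hulls have reached `A`, `aliveFn = 0`.** [folklore] -/
theorem aliveFn_eq_zero_of_not_disjoint (hW : Continuous (W ω)) (hW0 : W ω 0 = 0) (hA : IsStarHull A)
    (hdense : A ⊆ closure (range a)) (haH : ∀ k, 0 < (a k).im) (ht : ¬ Disjoint (closedHull (W ω) t) A) :
    aliveFn a W t ω = 0 := by
  refine le_antisymm ?_ (aliveFn_nonneg a W t ω)
  by_contra h
  exact lt_irrefl _ (aliveFn_lt_of_not_disjoint hW hW0 hA hdense haH ht (not_le.1 h))

/-! ### Continuity in time of the slid points -/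

/-- **A clipped distance at a rational time just after an alive time `s < t` is close to the
distance at `s`** (continuity in time of the flow of an alive point). [folklore] -/
theorem exists_ratTimes_norm_sub_lt (hW : Continuous (W ω)) {z : ℂ} {s : ℝ≥0}
    (hsT : (s : WithTop ℝ≥0) < swallowingTime (W ω) z) (hst : s < t) {ε : ℝ} (hε : 0 < ε) :
    ∃ q : ratTimes t, s < q.val ∧ (q.val : WithTop ℝ≥0) < swallowingTime (W ω) z ∧
      ‖(map (W ω) q.val z - W ω q.val) - (map (W ω) s z - W ω s)‖ < ε := by
  have hz0 : z ≠ W ω 0 := ne_driving_of_lt_swallowingTime hsT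
  obtain ⟨G, hG⟩ := exists_isSolution_swallowingTime_holds hW hz0
  have hs0 : (0 : ℝ) ≤ s := s.coe_nonneg
  have hsT' : ((s : ℝ).toNNReal : WithTop ℝ≥0) < swallowingTime (W ω) z := by simpa using hsT
  have hdom : (s : ℝ) ∈ {r : ℝ | 0 ≤ r ∧ (r.toNNReal : WithTop ℝ≥0) < swallowingTime (W ω) z} := ⟨hs0, hsT'⟩
  have hcont : ContinuousWithinAt (fun r : ℝ ↦ G r - W ω r.toNNReal)
      {r : ℝ | 0 ≤ r ∧ (r.toNNReal : WithTop ℝ≥0) < swallowingTime (W ω) z} s :=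
    (hG.continuousOn s hdom).sub ((Complex.continuous_ofReal.comp (hW.comp continuous_real_toNNReal)).continuousWithinAt)
  rw [Metric.continuousWithinAt_iff] at hcont
  obtain ⟨δ₃, hδ₃, hδ₃s⟩ := hcont ε hε
  -- room before `T_z` and before `t`
  obtain ⟨δ₄, hδ₄, hδ₄T⟩ : ∃ δ₄ : ℝ, 0 < δ₄ ∧ ∀ r : ℝ, (s : ℝ) ≤ r → r < s + δ₄ →
      (r.toNNReal : WithTop ℝ≥0) < swallowingTime (W ω) z := by
    rcases eq_or_ne (swallowingTime (W ω) z) ⊤ with htop | hnt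
    · exact ⟨1, one_pos, fun r _ _ ↦ by rw [htop]; exact WithTop.coe_lt_top _⟩
    · obtain ⟨σ, hσ⟩ := WithTop.ne_top_iff_exists.1 hnt
      have hsσ : (s : ℝ) < σ := by
        have : (s : WithTop ℝ≥0) < σ := by rw [hσ]; exact hsT
        exact_mod_cast this
      refine ⟨(σ - s) / 2, by linarith, fun r hr1 hr2 ↦ ?_⟩
      rw [← hσ, WithTop.coe_lt_coe, ← NNReal.coe_lt_coe, Real.coe_toNNReal r (hs0.trans hr1)]
      linarith
  set δ : ℝ := min δ₃ (min δ₄ ((t : ℝ) - s)) with hδ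
  have hst' : (s : ℝ) < t := by exact_mod_cast hst
  have hδ0 : 0 < δ := lt_min hδ₃ (lt_min hδ₄ (by linarith))
  obtain ⟨q, hsq, hqs⟩ := exists_rat_btwn (show (s : ℝ) < s + δ by linarith)
  have hq0 : 0 ≤ (q : ℝ) := hs0.trans hsq.le
  have hm1 := min_le_left δ₃ (min δ₄ ((t : ℝ) - s))
  have hm2 := min_le_right δ₃ (min δ₄ ((t : ℝ) - s))
  have hm3 := min_le_left δ₄ ((t : ℝ) - s)
  have hm4 := min_le_right δ₄ ((t : ℝ) - s)
  have hqt : (q : ℝ) ≤ t := by linarith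
  have hqT : ((q : ℝ).toNNReal : WithTop ℝ≥0) < swallowingTime (W ω) z := hδ₄T q hsq.le (by linarith)
  have hqdist : dist (q : ℝ) s < δ₃ := by
    rw [Real.dist_eq, abs_of_pos (by linarith)]; linarith
  have hnear := hδ₃s ⟨hq0, hqT⟩ hqdist
  rw [dist_eq_norm] at hnear
  set q' : ratTimes t := ⟨q, hq0, hqt⟩ with hq'
  have hqval : (q'.val : ℝ≥0) = (q : ℝ).toNNReal := by
    apply NNReal.eq; rw [Real.coe_toNNReal _ hq0]; rfl
  refine ⟨q', ?_, by rw [hqval]; exact hqT, ?_⟩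
  · rw [← NNReal.coe_lt_coe, hqval, Real.coe_toNNReal _ hq0]; exact hsq
  · have hmapq : map (W ω) q'.val z = G q := by
      rw [hqval, map_eq_of_isSolution hW hG hqT, Real.coe_toNNReal _ hq0]
    have hmaps : map (W ω) s z = G s := by
      rw [map_eq_of_isSolution hW hG hsT]
    have hWq : ((W ω q'.val : ℝ) : ℂ) = W ω (q : ℝ).toNNReal := by rw [hqval]
    have hWs : ((W ω s : ℝ) : ℂ) = W ω (s : ℝ).toNNReal := by rw [Real.toNNReal_coe]
    rw [hmapq, hmaps, hWq, hWs]
    exact hnear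

/-! ### The upper bound at an alive time -/

/-- **At an alive time `s ≤ t`, `aliveFn_t ≤ min dist(0, A_s - W_s) 1`.** [folklore] -/
theorem aliveFn_le_min_infDist (hW : Continuous (W ω)) (hA : IsStarHull A)
    (ha : ∀ k, a k ∈ A ∧ 0 < (a k).im) (hdense : A ⊆ closure (range a)) {s : ℝ≥0} (hst : s ≤ t)
    (hs : Disjoint (closedHull (W ω) s) A) :
    aliveFn a W t ω ≤ min (infDist 0 (slidHull (W ω) A s)) 1 := by
  -- per point bound, up to `ε`
  have hk : ∀ k, ∀ ε > 0, aliveFn a W t ω ≤ min ‖map (W ω) s (a k) - W ω s‖ 1 + ε := by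
    intro k ε hε
    have hkT : (s : WithTop ℝ≥0) < swallowingTime (W ω) (a k) := lt_swallowingTime_of_alive hA hs (ha k).1
    rcases hst.eq_or_lt with rfl | hlt
    · have h1 := aliveFn_le_clipDist_self a W s ω k
      rw [clipDist, if_pos hkT] at h1
      linarith
    · obtain ⟨q, -, hqT, hnear⟩ := exists_ratTimes_norm_sub_lt (t := t) hW hkT hlt hε
      have h1 := aliveFn_le_clipDist_rat a W ω k q
      rw [clipDist, if_pos hqT] at h1
      refine h1.trans ?_
      have h2 : ‖map (W ω) q.val (a k) - W ω q.val‖ ≤ ‖map (W ω) s (a k) - W ω s‖ + ε := by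
        have := norm_sub_norm_le (map (W ω) q.val (a k) - W ω q.val) (map (W ω) s (a k) - W ω s)
        linarith
      calc min ‖map (W ω) q.val (a k) - W ω q.val‖ 1 ≤ min (‖map (W ω) s (a k) - W ω s‖ + ε) 1 := min_le_min h2 le_rfl
        _ ≤ min ‖map (W ω) s (a k) - W ω s‖ 1 + ε := by
          rcases le_total ‖map (W ω) s (a k) - W ω s‖ 1 with h | h
          · rw [min_eq_left h]; exact (min_le_left _ _)
          · rw [min_eq_right h]; linarith [min_le_right (‖map (W ω) s (a k) - W ω s‖ + ε) 1]
  -- density of the slid points in the slid hull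
  refine le_of_forall_pos_lt_add fun ε hε ↦ ?_
  have hε2 : 0 < ε / 2 := by positivity
  have hB := isStarHull_slidHull_of_disjoint hW hA hs
  have hd := slidHull_subset_closure_range_slidPt (t := s) hW hA hdense hs
  set m := infDist (0 : ℂ) (slidHull (W ω) A s) with hm
  have hne : (slidHull (W ω) A s).Nonempty := ⟨_, mem_slidHull_iff.2 ⟨a 0, (ha 0).1, rfl⟩⟩
  obtain ⟨y, hy, hyd⟩ := (Metric.infDist_lt_iff hne).1 (show m < m + ε / 4 by linarith)
  obtain ⟨_, ⟨k, rfl⟩, hky⟩ := Metric.mem_closure_iff.1 (hd hy) (ε / 4) (by positivity)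
  have hnorm : ‖map (W ω) s (a k) - W ω s‖ < m + ε / 2 := by
    have h1 : dist (slidPt W a s k ω) 0 ≤ dist (slidPt W a s k ω) y + dist y 0 := dist_triangle _ _ _
    have h2 : dist (slidPt W a s k ω) y < ε / 4 := by rw [dist_comm]; exact hky
    rw [dist_comm] at hyd
    rw [dist_zero_right] at h1
    have : ‖map (W ω) s (a k) - W ω s‖ = ‖slidPt W a s k ω‖ := rfl
    rw [this]
    linarith
  have hkk := hk k (ε / 4) (by positivity)
  have h3 : min ‖map (W ω) s (a k) - W ω s‖ 1 ≤ min m 1 + ε / 2 := by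
    rcases le_total m 1 with h | h
    · rw [min_eq_left h]; exact (min_le_left _ _).trans hnorm.le
    · rw [min_eq_right h]; linarith [min_le_right ‖map (W ω) s (a k) - W ω s‖ 1]
  linarith


/-! ### The value at an alive time -/

/-- A uniform lower bound: if `c ≤ m_s` for all `s ≤ t` (all alive), then `min c 1 ≤ aliveFn_t`.
[folklore] -/
theorem min_le_aliveFn (hA : IsStarHull A) (ha : ∀ k, a k ∈ A) (halive : ∀ s, s ≤ t → Disjoint (closedHull (W ω) s) A)
    {c : ℝ} (hc : ∀ s, s ≤ t → c ≤ infDist 0 (slidHull (W ω) A s)) : min c 1 ≤ aliveFn a W t ω := by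
  refine le_aliveFn a W ω fun k q hq ↦ ?_
  have hlt : (q : WithTop ℝ≥0) < swallowingTime (W ω) (a k) := lt_swallowingTime_of_alive hA (halive q hq) (ha k)
  rw [clipDist, if_pos hlt]
  refine min_le_min ?_ le_rfl
  have hmem : map (W ω) q (a k) - W ω q ∈ slidHull (W ω) A q := mem_slidHull_iff.2 ⟨a k, ha k, rfl⟩
  have h1 := infDist_le_dist_of_mem (x := (0 : ℂ)) hmem
  rw [dist_comm, dist_zero_right] at h1
  exact (hc q hq).trans h1

/-- **At an alive time, `aliveFn_t = min (m s₀) 1` for a minimiser `s₀` of `s ↦ m_s = dist(0, A_s - W_s)`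
on `[0, t]`.** [folklore] -/
theorem exists_aliveFn_eq_min (hW : Continuous (W ω)) (hA : IsStarHull A) (hne : A.Nonempty)
    (ha : ∀ k, a k ∈ A ∧ 0 < (a k).im) (hdense : A ⊆ closure (range a)) (ht : Disjoint (closedHull (W ω) t) A) :
    ∃ s₀, s₀ ≤ t ∧ (∀ s, s ≤ t → infDist 0 (slidHull (W ω) A s₀) ≤ infDist 0 (slidHull (W ω) A s)) ∧
      aliveFn a W t ω = min (infDist 0 (slidHull (W ω) A s₀)) 1 := by
  set m : ℝ≥0 → ℝ := fun s ↦ infDist 0 (slidHull (W ω) A s) with hm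
  have halive : ∀ s ∈ Icc (0 : ℝ≥0) t, Disjoint (closedHull (W ω) s) A := fun s hs ↦ alive_mono hs.2 ht
  have hcont : ContinuousOn m (Icc 0 t) := fun s hs ↦
    (continuousWithinAt_infDist_slidHull hW hA hne (halive s hs)).mono fun s' hs' ↦ halive s' hs'
  obtain ⟨s₀, hs₀, hmin⟩ := isCompact_Icc.exists_isMinOn ⟨0, left_mem_Icc.2 bot_le⟩ hcont
  refine ⟨s₀, hs₀.2, fun s hs ↦ hmin (show s ∈ Icc (0 : ℝ≥0) t from ⟨bot_le, hs⟩), le_antisymm ?_ ?_⟩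
  · exact aliveFn_le_min_infDist hW hA ha hdense hs₀.2 (halive s₀ hs₀)
  · exact min_le_aliveFn hA (fun k ↦ (ha k).1) (fun s hs ↦ halive s ⟨bot_le, hs⟩)
      fun s hs ↦ hmin (show s ∈ Icc (0 : ℝ≥0) t from ⟨bot_le, hs⟩)

/-! ### The time structure of the alive set -/

/-- **The alive times are open to the right**: at a hull-hitting time some point of `A` is
swallowed (`IsHullHitTime.exists_mem_closedHull`). [folklore] -/
theorem exists_lt_disjoint (hW : Continuous (W ω)) (hA : IsStarHull A) (ht : Disjoint (closedHull (W ω) t) A) :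
    ∃ t₁, t < t₁ ∧ Disjoint (closedHull (W ω) t₁) A := by
  by_contra h
  push Not at h
  have hhit : IsHullHitTime (W ω) A t := ⟨fun s hs ↦ alive_mono hs.le ht, fun s hs ↦ h s hs⟩
  obtain ⟨z, hzA, hzK⟩ := hhit.exists_mem_closedHull hW hA.isBoundedHull.isCompact
  exact Set.disjoint_left.1 ht hzK hzA

/-- If all times `< t₀` are alive but `t₀ > 0` is not, some `z ∈ A` is swallowed exactly at `t₀`.
[folklore] -/
theorem exists_swallowingTime_eq (hA : IsStarHull A) {t₀ : ℝ≥0}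
    (hbefore : ∀ s, s < t₀ → Disjoint (closedHull (W ω) s) A) (hdead : ¬ Disjoint (closedHull (W ω) t₀) A) :
    ∃ z ∈ A, swallowingTime (W ω) z = t₀ := by
  obtain ⟨z, hzK, hzA⟩ := Set.not_disjoint_iff.1 hdead
  refine ⟨z, hzA, le_antisymm hzK.2 ?_⟩
  by_contra hlt
  rw [not_le] at hlt
  obtain ⟨σ, hσ⟩ := WithTop.ne_top_iff_exists.1 (ne_top_of_lt hlt)
  have hσt : σ < t₀ := by rw [← hσ] at hlt; exact_mod_cast hlt
  obtain ⟨s, hσs, hst⟩ := exists_between hσt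
  have h1 : (s : WithTop ℝ≥0) < swallowingTime (W ω) z := lt_swallowingTime_of_alive hA (hbefore s hst) hzA
  rw [← hσ] at h1
  exact lt_irrefl _ ((WithTop.coe_lt_coe.1 h1).trans hσs)

/-! ### Continuity of `t ↦ aliveFn_t` -/

/-- Continuity estimate at an alive time (helper for `continuous_aliveFn`). [folklore] -/
theorem continuousAt_alive (hW : Continuous (W ω)) (hA : IsStarHull A) (hne : A.Nonempty)
    (ha : ∀ k, a k ∈ A ∧ 0 < (a k).im) (hdense : A ⊆ closure (range a)) {t₀ : ℝ≥0}
    (h₀ : Disjoint (closedHull (W ω) t₀) A) {ε : ℝ} (hε : 0 < ε) :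
    ∃ δ > 0, ∀ ⦃t : ℝ≥0⦄, dist t t₀ < δ → dist (aliveFn a W t ω) (aliveFn a W t₀ ω) < ε := by
  set m : ℝ≥0 → ℝ := fun s ↦ infDist 0 (slidHull (W ω) A s) with hm
  obtain ⟨t₁, ht₁, halive₁⟩ := exists_lt_disjoint hW hA h₀
  have hcm := continuousWithinAt_infDist_slidHull (s := t₀) hW hA hne h₀
  rw [Metric.continuousWithinAt_iff] at hcm
  obtain ⟨δ₁, hδ₁, hδ₁m⟩ := hcm (ε / 3) (by positivity)
  have ht₁' : (t₀ : ℝ) < t₁ := by exact_mod_cast ht₁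
  refine ⟨min δ₁ ((t₁ : ℝ) - t₀), lt_min hδ₁ (by linarith), fun t ht ↦ ?_⟩
  have ht1 : |(t : ℝ) - t₀| < δ₁ := by rw [← NNReal.dist_eq]; exact lt_of_lt_of_le ht (min_le_left _ _)
  have ht2 : t < t₁ := by
    have h1 : |(t : ℝ) - t₀| < (t₁ : ℝ) - t₀ := by rw [← NNReal.dist_eq]; exact lt_of_lt_of_le ht (min_le_right _ _)
    have h2 := le_abs_self ((t : ℝ) - t₀)
    exact_mod_cast (show (t : ℝ) < t₁ by linarith)
  have hat : Disjoint (closedHull (W ω) t) A := alive_mono ht2.le halive₁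
  obtain ⟨s₀, hs₀t, hs₀min, hF₀⟩ := exists_aliveFn_eq_min hW hA hne ha hdense h₀
  obtain ⟨s₁, hs₁t, hs₁min, hF₁⟩ := exists_aliveFn_eq_min hW hA hne ha hdense hat
  have hnear : ∀ s, Disjoint (closedHull (W ω) s) A → |(s : ℝ) - t₀| < δ₁ → |m s - m t₀| < ε / 3 := fun s hs hsd ↦ by
    have := hδ₁m hs (by rwa [NNReal.dist_eq])
    rwa [Real.dist_eq] at this
  rw [Real.dist_eq, hF₀, hF₁]
  change |min (m s₁) 1 - min (m s₀) 1| < ε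
  have hms₀t₀ : m s₀ ≤ m t₀ := hs₀min t₀ le_rfl
  have hs₀t' : (s₀ : ℝ) ≤ t₀ := by exact_mod_cast hs₀t
  have hs₁t' : (s₁ : ℝ) ≤ t := by exact_mod_cast hs₁t
  have key : ∀ x y η : ℝ, 0 ≤ η → y - η ≤ x → x ≤ y + η → |min x 1 - min y 1| ≤ η := by
    intro x y η hη h1 h2
    rw [abs_le]
    constructor
    · rcases le_total y 1 with h | h
      · rw [min_eq_left h]
        rcases le_total x 1 with h' | h'
        · rw [min_eq_left h']; linarith
        · rw [min_eq_right h']; linarith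
      · rw [min_eq_right h]
        rcases le_total x 1 with h' | h'
        · rw [min_eq_left h']; linarith
        · rw [min_eq_right h']; linarith
    · rcases le_total y 1 with h | h
      · rw [min_eq_left h]; linarith [min_le_left x 1]
      · rw [min_eq_right h]; linarith [min_le_right x 1]
  rcases le_total t₀ t with htt | htt
  · -- `t₀ ≤ t`: `m s₁ ≤ m s₀` and `m s₁ ≥ m s₀ - ε/3`
    have htt' : (t₀ : ℝ) ≤ t := by exact_mod_cast htt
    have h1 : m s₁ ≤ m s₀ := hs₁min s₀ (hs₀t.trans htt)
    have h2 : m s₀ - ε / 3 ≤ m s₁ := by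
      rcases le_total s₁ t₀ with hs | hs
      · linarith [hs₀min s₁ hs]
      · have hs' : (t₀ : ℝ) ≤ s₁ := by exact_mod_cast hs
        have hds : |(s₁ : ℝ) - t₀| < δ₁ := by
          rw [abs_of_nonneg (by linarith)]
          rw [abs_of_nonneg (by linarith)] at ht1
          linarith
        have := hnear s₁ (alive_mono hs₁t hat) hds
        rw [abs_lt] at this
        linarith
    have := key (m s₁) (m s₀) (ε / 3) (by positivity) h2 (by linarith)
    linarith
  · -- `t ≤ t₀`: `m s₀ ≤ m s₁` and `m s₁ ≤ m s₀ + 2ε/3`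
    have htt' : (t : ℝ) ≤ t₀ := by exact_mod_cast htt
    have h1 : m s₀ ≤ m s₁ := hs₀min s₁ (hs₁t.trans htt)
    have ht1' : (t₀ : ℝ) - t < δ₁ := by
      rw [abs_sub_comm, abs_of_nonneg (by linarith)] at ht1; exact ht1
    have h2 : m s₁ ≤ m s₀ + 2 * ε / 3 := by
      rcases le_total s₀ t with hs | hs
      · linarith [hs₁min s₀ hs]
      · have hs' : (t : ℝ) ≤ s₀ := by exact_mod_cast hs
        have hds₀ : |(s₀ : ℝ) - t₀| < δ₁ := by
          rw [abs_sub_comm, abs_of_nonneg (by linarith)]; linarith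
        have e1 := hnear s₀ (alive_mono hs₀t h₀) hds₀
        have e2 := hnear t hat ht1
        rw [abs_lt] at e1 e2
        have e3 : m s₁ ≤ m t := hs₁min t le_rfl
        linarith
    have := key (m s₁) (m s₀) (2 * ε / 3) (by positivity) (by linarith) h2
    linarith

/-- Continuity estimate at a dead time (helper for `continuous_aliveFn`). [folklore] -/
theorem continuousAt_dead (hW : Continuous (W ω)) (hW0 : W ω 0 = 0) (hA : IsStarHull A)
    (ha : ∀ k, a k ∈ A ∧ 0 < (a k).im) (hdense : A ⊆ closure (range a)) {t₀ : ℝ≥0}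
    (h₀ : ¬ Disjoint (closedHull (W ω) t₀) A) {ε : ℝ} (hε : 0 < ε) :
    ∃ δ > 0, ∀ ⦃t : ℝ≥0⦄, dist t t₀ < δ → dist (aliveFn a W t ω) (aliveFn a W t₀ ω) < ε := by
  have hF0 : ∀ t, 0 ≤ aliveFn a W t ω := fun t ↦ aliveFn_nonneg a W t ω
  have hdead : ∀ t, ¬ Disjoint (closedHull (W ω) t) A → aliveFn a W t ω = 0 := fun t ht ↦
    aliveFn_eq_zero_of_not_disjoint hW hW0 hA hdense (fun k ↦ (ha k).2) ht
  have hFt₀ : aliveFn a W t₀ ω = 0 := hdead t₀ h₀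
  have hafter : ∀ t, t₀ ≤ t → aliveFn a W t ω = 0 := fun t ht ↦ hdead t fun h ↦ h₀ (alive_mono ht h)
  -- a `δ > 0` such that `aliveFn t < ε` for `t₀ - δ < t < t₀`
  obtain ⟨δ, hδ, hbefore⟩ : ∃ δ : ℝ, 0 < δ ∧ ∀ t : ℝ≥0, t < t₀ → (t₀ : ℝ) - t < δ → aliveFn a W t ω < ε := by
    by_cases hall : ∀ s, s < t₀ → Disjoint (closedHull (W ω) s) A
    · rcases (zero_le (α := ℝ≥0) (a := t₀)).eq_or_lt with ht0 | ht0
      · refine ⟨1, one_pos, fun t ht _ ↦ absurd ht ?_⟩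
        rw [← ht0]; exact not_lt_bot
      · -- a point swallowed exactly at `t₀`; extension criterion
        obtain ⟨z, hzA, hzT⟩ := exists_swallowingTime_eq hA hall h₀
        have hz0 : z ≠ W ω 0 := by
          rw [hW0]; intro h
          exact hA.zero_notMem (by rw [Complex.ofReal_zero] at h; rwa [← h])
        obtain ⟨G, hG⟩ := exists_isSolution_swallowingTime_holds hW hz0
        rw [hzT] at hG
        have hε2 : (0 : ℝ) < ε / 2 := by positivity
        obtain ⟨s, hs0, hsτ, hclose⟩ : ∃ s : ℝ, 0 ≤ s ∧ s < t₀ ∧ ‖G s - W ω s.toNNReal‖ < ε / 2 := by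
          by_contra hcon
          push Not at hcon
          have := hG.coe_lt_swallowingTime_of_le_norm_sub hW ht0 (δ := ⟨ε / 2, hε2.le⟩) hε2
            fun r hr0 hrτ ↦ hcon r hr0 hrτ
          rw [hzT] at this
          exact lt_irrefl _ this
        set s' : ℝ≥0 := s.toNNReal with hs'
        have hss' : (s' : ℝ) = s := Real.coe_toNNReal s hs0
        have hs'τ : s' < t₀ := by rw [← NNReal.coe_lt_coe, hss']; exact hsτ
        have hmaps : map (W ω) s' z = G s := by
          rw [map_eq_of_isSolution hW hG (by exact_mod_cast hs'τ), hss']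
        refine ⟨(t₀ : ℝ) - s, by linarith, fun t ht htd ↦ ?_⟩
        have hs't : s' ≤ t := by
          rw [← NNReal.coe_le_coe, hss']; linarith
        have hat : Disjoint (closedHull (W ω) t) A := hall t ht
        have h1 := aliveFn_le_min_infDist hW hA ha hdense hs't (alive_mono hs't hat)
        have hmem : map (W ω) s' z - W ω s' ∈ slidHull (W ω) A s' := mem_slidHull_iff.2 ⟨z, hzA, rfl⟩
        have h2 := infDist_le_dist_of_mem (x := (0 : ℂ)) hmem
        rw [dist_comm, dist_zero_right, hmaps] at h2
        have hWs : ((W ω s' : ℝ) : ℂ) = W ω s.toNNReal := by rw [hs']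
        rw [hWs] at h2
        calc aliveFn a W t ω ≤ min (infDist 0 (slidHull (W ω) A s')) 1 := h1
          _ ≤ infDist 0 (slidHull (W ω) A s') := min_le_left _ _
          _ < ε := by linarith
    · push Not at hall
      obtain ⟨s, hst₀, hsdead⟩ := hall
      have hst₀' : (s : ℝ) < t₀ := by exact_mod_cast hst₀
      refine ⟨(t₀ : ℝ) - s, by linarith, fun t ht htd ↦ ?_⟩
      have hst : s ≤ t := by
        have : (s : ℝ) ≤ t := by linarith
        exact_mod_cast this
      rw [hdead t fun h ↦ hsdead (alive_mono hst h)]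
      exact hε
  refine ⟨δ, hδ, fun t ht ↦ ?_⟩
  rw [hFt₀, Real.dist_eq, sub_zero, abs_of_nonneg (hF0 t)]
  rcases lt_or_ge t t₀ with htt | htt
  · refine hbefore t htt ?_
    have htt' : (t : ℝ) ≤ t₀ := by exact_mod_cast htt.le
    rw [NNReal.dist_eq, abs_sub_comm, abs_of_nonneg (by linarith)] at ht
    exact ht
  · rw [hafter t htt]; exact hε

/-- **`t ↦ aliveFn_t` is continuous** (for a continuous driver from `0` and a nonempty `*`-hull).
[cite: LawlerSchrammWerner2003Restriction, §5 (localisation of Y_t, t < T)] -/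
theorem continuous_aliveFn (hW : Continuous (W ω)) (hW0 : W ω 0 = 0) (hA : IsStarHull A) (hne : A.Nonempty)
    (ha : ∀ k, a k ∈ A ∧ 0 < (a k).im) (hdense : A ⊆ closure (range a)) :
    Continuous fun t ↦ aliveFn a W t ω := by
  refine continuous_iff_continuousAt.2 fun t₀ ↦ Metric.continuousAt_iff.2 fun ε hε ↦ ?_
  by_cases h₀ : Disjoint (closedHull (W ω) t₀) A
  · exact continuousAt_alive hW hA hne ha hdense h₀ hε
  · exact continuousAt_dead hW hW0 hA ha hdense h₀ hε

end Loewner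

end Literature.Probability.RandomPlanarGeometry
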